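import Mathlib
import Literature.NumberTheory.Automorphic.AutomorphicGaloisConjProofs
import Literature.NumberTheory.Automorphic.AutomorphicRepsGLCuspidalL2Step3bHolds
import Literature.NumberTheory.Automorphic.GLnAdelicStructureProofs
import Literature.NumberTheory.Automorphic.GaloisActionPlaces
import Literature.NumberTheory.Automorphic.ChebotarevArtinRepHolds
import Literature.NumberTheory.GaloisRepresentations.KummerCharacters
import Literature.NumberTheory.GaloisRepresentations.AbsGaloisOuterConj
import HarnessLib

/-!
# Kummer characters: coherent families need not be tau-invariant (the twist-unpackaging stubs
StubAdmissiblePowers / CoherentFamiliesTauInvariant are false)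

Topic `Literature/NumberTheory/GaloisRepresentations` (librarian move 2026-08-16 of the gate-parked
module `Literature/Uncategorized/StubAdmissiblePowers.lean` — accept-time relocation of propositions
written inline in a `Summits/` proposal, human ruling 2026-08-15 — to the directory of its
mathematics; declarations byte-identical, only the namespace, this directory's, is new; the old
names remain behind as deprecated aliases).

* `Literature.NumberTheory.GaloisRepresentations.CoherentFamiliesTauInvariant` — **REFUTED, deprecated** (see below)
* `Literature.NumberTheory.GaloisRepresentations.StubAdmissiblePowers` — **REFUTED, deprecated** (see below)

## Verdict clean-up (2026-08-16): both propositions are RETIRED FROM LITERATURE DEBT as refuted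

Neither proposition is a literature fact and neither can ever be discharged: both are FALSE, and
their refutations are kernel-checked theorems OF THIS FILE (axioms `propext`, `Classical.choice`,
`Quot.sound` only):

* `Literature.NumberTheory.GaloisRepresentations.stubAdmissiblePowers_false : ¬ StubAdmissiblePowers`
  (rank `n = 0` + the Kummer family; the tenured prove-seat's verdict `refuted`, re-checked), and
* `Literature.NumberTheory.GaloisRepresentations.coherentFamiliesTauInvariant_false : ¬ CoherentFamiliesTauInvariant`
  (Kummer character of `∛2` over `ℚ(ζ₃)/ℚ` at `p = 3`; p85924).

Following the verdicts, the two `def`s are kept **statement byte-for-byte** but carry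
`@[deprecated]` with a pointer to the refuting theorem: they cannot be deleted while the
refutations name them — in this file (`coherentFamiliesTauInvariant_of_stubB`,
`stubAdmissiblePowers_false_of`, `coherentFamiliesTauInvariant_false`,
`stubAdmissiblePowers_false`; each silences `linter.deprecated` for itself only, with a
REMOVE-WHEN note) and, by name, in the `Summits` negative-knowledge records
`Summits/Langlands/Langlands/Theorems/TwistUnpackaging/Negative/StubAdmissiblePowersFalse.lean`
(`Summit.Langlands.Langlands.Theorems.TwistUnpackaging.Negative.stubAdmissiblePowers_false`,
`…coherentFamiliesTauInvariant_false`, `…coherentFamiliesTauInvariant_of_stubB`,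
`…stubAdmissiblePowers_false_of`) and `Summits/Langlands/Langlands/Cruxes/TwistUnpackaging/Disproof.lean`
(`stubB_false`). No `StubAdmissiblePowers_holds` / `CoherentFamiliesTauInvariant_holds` can
exist; nothing may be built on either proposition except its negation. There is NO corrected
Literature statement to vendor: the propositions transcribe a stub of a route skeleton (our own
problem-side scaffolding, not a published result); the problem-side repair recorded by the
disprover (add `0 < n` to stub B) belongs to the route, not to `Literature/`.
-/

namespace Literature.NumberTheory.GaloisRepresentations

open Literature.NumberTheory.Automorphic
open _root_.NumberField _root_.IsDedekindDomain _root_.Field _root_.Polynomial _root_.IntermediateField Filter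
open _root_.MeasureTheory

/-- **Refuted — deprecated (verdict clean-up 2026-08-16); kept, statement byte-for-byte, only
because its refutations name it; retired from literature debt (no `_holds` can exist).**
VERBATIM copy of stub B `…Cruxes.TwistUnpackaging.KummerChebotarevSeparatingTwists.stub_admissiblePowers`
of the registered skeleton `Lines/kummer-chebotarev-separating-twists.lean` (sha `e396fa773a0d`)
("all but at most one power `ψʲ`, `0 < j < p`, is robustly non-`τ`-invariant on `π`"), which
quantifies over EVERY rank `n`, including `n = 0`.
FALSE as typed — **refutation (kernel-checked, kept, this file):**
`Literature.NumberTheory.GaloisRepresentations.stubAdmissiblePowers_false : ¬ StubAdmissiblePowers` (at `n = 0` a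
cuspidal datum of `GL_0` exists and every Satake parameter is the empty multiset, so the
conclusion collapses to `{1, …, p-1} ⊆ {j₀}`, absurd for `p ≥ 3`, while the hypotheses are met by
the Kummer family of `exists_coherentFamily_not_tauInvariant`; reduction
`coherentFamiliesTauInvariant_of_stubB` + `coherentFamiliesTauInvariant_false`). The same
refutation is recorded problem-side as
`Summit.Langlands.Langlands.Theorems.TwistUnpackaging.Negative.stubAdmissiblePowers_false`.
No corrected statement is vendored in `Literature/`: this is a transcript of our own route
scaffolding, not a published result (the disprover's problem-side repair is to add `0 < n`).
[folklore] -/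
@[deprecated "refuted as stated (rank n = 0): see \
  Literature.NumberTheory.GaloisRepresentations.stubAdmissiblePowers_false (this file) and \
  Summit.Langlands.Langlands.Theorems.TwistUnpackaging.Negative.stubAdmissiblePowers_false; \
  no corrected Literature statement exists (route-stub transcript; problem-side repair: add 0 < n)"
  (since := "2026-08-16")]
def StubAdmissiblePowers : Prop :=
  ∀ (F₀ F : Type) [Field F₀] [NumberField F₀] [Field F] [NumberField F] [Algebra F₀ F]
    (τ : F ≃ₐ[F₀] F), Module.finrank F₀ F = 2 → τ ≠ 1 →
  ∀ (n : ℕ) (hcpt : isCompact_glFiniteIntegralLevel n F) (π : CuspidalAutomorphicRepData n F hcpt)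
    (p : ℕ) (Q : Set (HeightOneSpectrum (𝓞 F))) (c : HeightOneSpectrum (𝓞 F) → ℂ)
    (e : ℕ → FramedGaloisRep F ℂ 1),
    p.Prime → n < p → Q.Finite →
    (∀ v ∉ Q, c v ^ p = 1) →
    (∀ j : ℕ, ∀ v ∉ Q, (e j).HasFrobCharpolyAt v (Polynomial.X - Polynomial.C (c v ^ j))) →
    (∃ w₀, w₀ ∉ Q ∧ τ • w₀ ∉ Q ∧ c (τ • w₀) ≠ c w₀) →
  ∃ j₀ : ℕ, ∀ j : ℕ, 0 < j → j < p → j ≠ j₀ →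
    ∃ᶠ w in Filter.cofinite, ∃ (α β : Multiset ℂ) (a a' : ℂ),
      π.1.HasSatakeParamAt w α ∧ π.1.HasSatakeParamAt (τ • w) β ∧
      (e j).HasFrobCharpolyAt w (Polynomial.X - Polynomial.C a) ∧
      (e j).HasFrobCharpolyAt (τ • w) (Polynomial.X - Polynomial.C a') ∧
      β.map (fun b ↦ b * a') ≠ α.map (fun x ↦ x * a)

/-- **Refuted — deprecated (verdict clean-up 2026-08-16); kept, statement byte-for-byte, only
because its refutations name it; retired from literature debt (no `_holds` can exist).**
**The Galois-side shadow of stub B at rank 0**: every "coherent exponent-`p` family"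
(`p ≥ 3` prime; `c` a `μ_p`-valued function off a finite `Q`; rank-one Artin avatars `e j` with
arithmetic-Frobenius value `c v ^ j` at every `v ∉ Q`) over ANY quadratic `F/F₀` is
`τ`-invariant off `Q`.
FALSE — **refutation (kernel-checked, kept, this file):**
`Literature.NumberTheory.GaloisRepresentations.coherentFamiliesTauInvariant_false : ¬ CoherentFamiliesTauInvariant`
(p85924; the Kummer character of `∛2` over `ℚ(ζ₃)/ℚ` at `p = 3`,
`exists_coherentFamily_not_tauInvariant`: numerically its values at the two primes `(3+ζ₃)`,
`(3+ζ₃²)` above `7` are `ζ₃`, `ζ₃²`; structurally, `τ`-invariance would force `∛2 ∈ ℚ(ζ₃)` by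
density of Frobenii + the Kummer conjugation lemma). The same refutation is recorded problem-side
as `Summit.Langlands.Langlands.Theorems.TwistUnpackaging.Negative.coherentFamiliesTauInvariant_false`.
No corrected statement is vendored in `Literature/`: the proposition is the shadow of a route stub
(our own scaffolding), not a published result. [folklore] -/
@[deprecated "refuted as stated: see \
  Literature.NumberTheory.GaloisRepresentations.coherentFamiliesTauInvariant_false (this file) and \
  Summit.Langlands.Langlands.Theorems.TwistUnpackaging.Negative.coherentFamiliesTauInvariant_false; \
  no corrected Literature statement exists (shadow of a route stub)"
  (since := "2026-08-16")]
def CoherentFamiliesTauInvariant : Prop :=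
  ∀ (F₀ F : Type) [Field F₀] [NumberField F₀] [Field F] [NumberField F] [Algebra F₀ F]
    (τ : F ≃ₐ[F₀] F), Module.finrank F₀ F = 2 → τ ≠ 1 →
  ∀ (p : ℕ) (Q : Set (HeightOneSpectrum (𝓞 F))) (c : HeightOneSpectrum (𝓞 F) → ℂ)
    (e : ℕ → FramedGaloisRep F ℂ 1),
    p.Prime → 3 ≤ p → Q.Finite →
    (∀ v ∉ Q, c v ^ p = 1) →
    (∀ j : ℕ, ∀ v ∉ Q, (e j).HasFrobCharpolyAt v (Polynomial.X - Polynomial.C (c v ^ j))) →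
    ∀ w₀, w₀ ∉ Q → τ • w₀ ∉ Q → c (τ • w₀) = c w₀

/-!
## Both propositions are FALSE — refutations proved in place

The two propositions above are not literature facts: they are the *targets* of a refutation
(negative knowledge VIII of the crux `TwistUnpackaging`), relocated here verbatim by the gate.
So that this Literature file certifies their falsity by itself (Literature cannot import
`Summits`), the kernel-checked refutation is reproduced below from the `Summits` negative files
`Summits/Langlands/Langlands/Theorems/TwistUnpackaging/Negative/CoherentCubicFamily.lean` and
`…/Negative/StubAdmissiblePowersFalse.lean` (same statements, same proofs, same names, now in the
namespace `Literature.NumberTheory.GaloisRepresentations`; the `Summits` copies may simply be replaced by these):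

* `outerConj_smul_kummerRoot` — Kummer conjugation lemma: `F/F₀` Galois, `μ_n ⊆ F`, `a ∈ F₀ˣ`,
  `αⁿ = a` in `F̄`; if `σ ∈ Γ_F` acts on `α` through `u ∈ F` then the outer conjugate `θ_t σ`
  (`t ∈ Γ_{F₀}`, `AbsGaloisOuterConj`) acts through `t̄ u` (`t̄ = absGaloisQuot F₀ F t`).
* `inflate_kummer_apply_coe` — the rank-one Artin representation `χʲ ∘ r_{F(α)}` has entry
  `ι(u)ʲ` at such a `σ`.
* `exists_coherentFamily_not_tauInvariant` — over `F = ℚ(ζ₃)`: a finite `Q`, `c : places → μ₃`,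
  `e j = χʲ ∘ r` (`χ` the Kummer character of `∛2`) with arithmetic-Frobenius value `c v ^ j` at
  every `v ∉ Q`, and a place `w₀ ∉ Q ∪ τ⁻¹Q` with `c (τ • w₀) ≠ c w₀` (structurally: otherwise
  `χ ∘ r` and its outer conjugate share their Frobenius data almost everywhere and coincide by
  `frobenius_dense` + the PROVED `chebotarev_artinRep_holds`; the conjugation lemma with
  `τ ζ₃ = ζ₃²` forces `Γ_F` to fix `∛2`, so `∛2 ∈ ℚ(ζ₃)` and norms give a rational cube equal
  to `4`).
* `coherentFamiliesTauInvariant_false : ¬ CoherentFamiliesTauInvariant`.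
* `nonempty_cuspidalAutomorphicRepData_zero`, `coherentFamiliesTauInvariant_of_stubB`
  (rank `0`: every Satake parameter is the empty multiset) and
  `stubAdmissiblePowers_false : ¬ StubAdmissiblePowers`.
-/

section KummerConj

variable {F₀ F : Type} [Field F₀] [Field F] [NumberField F] [Algebra F₀ F]

/-- **Kummer conjugation lemma.** `F/F₀` Galois, `μ_n ⊆ F`, `a ∈ F₀ˣ`, `αⁿ = a` in `F̄` (written
through `F`).  If `σ ∈ Γ_F` acts on `α` through `u ∈ F` (`σ α = u α`), then the outer conjugate
`θ_t σ` (`t ∈ Γ_{F₀}`) acts through `t̄ u`: `(θ_t σ) α = (t̄ u) α`,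
`t̄ = absGaloisQuot F₀ F t ∈ Gal(F/F₀)`.
(Copy of the `Summits`-side theorem of the same name; see the section doc above.)
[folklore] -/
theorem outerConj_smul_kummerRoot [IsGalois F₀ F] {n : ℕ} (hn : 0 < n) {ζ : F}
    (hζ : IsPrimitiveRoot ζ n) {a : F₀} (ha : a ≠ 0) {α : AlgebraicClosure F}
    (hα : α ^ n = algebraMap F (AlgebraicClosure F) (algebraMap F₀ F a))
    (t : absoluteGaloisGroup F₀) (σ : absoluteGaloisGroup F) {u : F}
    (hu : σ • α = algebraMap F (AlgebraicClosure F) u * α) :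
    absGaloisOuterConj F₀ F t σ • α =
      algebraMap F (AlgebraicClosure F) (absGaloisQuot F₀ F t u) * α := by
  classical
  haveI : NeZero n := ⟨hn.ne'⟩
  have hinj : Function.Injective (absClosureEmbedding F₀ F) :=
    (absClosureEmbedding_bijective F₀ F).1
  obtain ⟨α₀, rfl⟩ := (absClosureEmbedding_bijective F₀ F).2 α
  have ha' : algebraMap F₀ (AlgebraicClosure F₀) a ≠ 0 :=
    (map_ne_zero_iff _ (algebraMap F₀ (AlgebraicClosure F₀)).injective).2 ha
  -- `α₀ⁿ = a`
  have hα₀ : α₀ ^ n = algebraMap F₀ (AlgebraicClosure F₀) a := by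
    apply hinj
    rw [map_pow, hα, AlgHom.commutes, ← IsScalarTower.algebraMap_apply]
  have hα₀0 : α₀ ≠ 0 := by
    rintro rfl
    rw [zero_pow hn.ne'] at hα₀
    exact ha' hα₀.symm
  -- `res σ • α₀ = e u * α₀`
  have hu₀ : absGaloisRestrict F₀ F σ • α₀ = absEmbedding F₀ F u * α₀ := by
    apply hinj
    rw [absGaloisRestrict_apply_smul, hu, map_mul, absClosureEmbedding_absEmbedding]
  -- the ratio `t⁻¹ α₀ / α₀` is an `n`-th root of unity, i.e. `e (ζ ^ i)`
  have hζ' : IsPrimitiveRoot (absEmbedding F₀ F ζ) n :=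
    hζ.map_of_injective (f := (absEmbedding F₀ F : F →+* AlgebraicClosure F₀))
      (absEmbedding F₀ F : F →+* AlgebraicClosure F₀).injective
  have hfix : ∀ g : absoluteGaloisGroup F₀,
      g • algebraMap F₀ (AlgebraicClosure F₀) a = algebraMap F₀ (AlgebraicClosure F₀) a :=
    fun g => by rw [absoluteGaloisGroup.smul_def, AlgEquiv.commutes]
  obtain ⟨i, -, hi⟩ : ∃ i < n, absEmbedding F₀ F ζ ^ i = (t⁻¹ • α₀) * α₀⁻¹ := by
    apply hζ'.eq_pow_of_pow_eq_one
    rw [mul_pow, ← smul_pow', hα₀, inv_pow, hα₀, hfix, mul_inv_cancel₀ ha']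
  have hν : t⁻¹ • α₀ = absEmbedding F₀ F (ζ ^ i) * α₀ := by
    rw [map_pow, hi, inv_mul_cancel_right₀ hα₀0]
  have hν0 : absEmbedding F₀ F (absGaloisQuot F₀ F t (ζ ^ i)) ≠ 0 :=
    (map_ne_zero_iff _ (absEmbedding F₀ F : F →+* AlgebraicClosure F₀).injective).2
      ((map_ne_zero_iff _ (absGaloisQuot F₀ F t).injective).2
        (pow_ne_zero _ (hζ.ne_zero hn.ne')))
  -- `t • α₀ = (t̄ ζⁱ)⁻¹ α₀`
  have ht : t • α₀ = (absEmbedding F₀ F (absGaloisQuot F₀ F t (ζ ^ i)))⁻¹ * α₀ := by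
    have h1 : t • (t⁻¹ • α₀) = α₀ := smul_inv_smul t α₀
    rw [hν, smul_mul', ← absEmbedding_absGaloisQuot_apply F₀ F t (ζ ^ i)] at h1
    rw [eq_inv_mul_iff_mul_eq₀ hν0, h1]
  -- the computation
  rw [← absGaloisRestrict_apply_smul, absGaloisRestrict_absGaloisOuterConj, mul_smul, mul_smul, hν,
    smul_mul', absGaloisRestrict_smul_absEmbedding F₀ F σ (ζ ^ i), hu₀, smul_mul', smul_mul',
    ← absEmbedding_absGaloisQuot_apply F₀ F t (ζ ^ i), ← absEmbedding_absGaloisQuot_apply F₀ F t u,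
    ht, ← absClosureEmbedding_absEmbedding F₀ F, ← map_mul]
  congr 1
  field_simp

omit [NumberField F] in
/-- **Values of the inflated Kummer character.**  If `σ α = u α` with `u ∈ F`, then the rank-one
Artin representation `χʲ ∘ r_{F(α)}` has matrix entry `ι(u)ʲ` at `σ`.
(Copy of the `Summits`-side theorem of the same name; see the section doc above.)
[folklore] -/
theorem inflate_kummer_apply_coe (ι : AlgebraicClosure F →+* ℂ) {α : AlgebraicClosure F}
    (hα0 : α ≠ 0) [FiniteDimensional F F⟮α⟯] [Normal F F⟮α⟯]
    {χ : (F⟮α⟯ ≃ₐ[F] F⟮α⟯) →* ℂˣ}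
    (hχ : ∀ g, ((χ g : ℂˣ) : ℂ) * ι α = ι ((g (AdjoinSimple.gen F α) : F⟮α⟯) : AlgebraicClosure F))
    (j : ℕ) (σ : absoluteGaloisGroup F) {u : F}
    (hu : σ • α = algebraMap F (AlgebraicClosure F) u * α) :
    ((inflateCharacter F⟮α⟯ (χ ^ j) σ : GL (Fin 1) ℂ) : Matrix (Fin 1) (Fin 1) ℂ) 0 0 =
      ι (algebraMap F (AlgebraicClosure F) u) ^ j := by
  rw [inflateCharacter_apply_coe, MonoidHom.pow_apply, Units.val_pow_eq_pow_val]
  congr 1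
  have h := hχ (absRestrictNormalHom F⟮α⟯ σ)
  have hgen : ((absRestrictNormalHom F⟮α⟯ σ (AdjoinSimple.gen F α) : F⟮α⟯) : AlgebraicClosure F) =
      σ • α :=
    AlgEquiv.restrictNormalHom_apply F⟮α⟯ _ _
  rw [hgen, hu, map_mul] at h
  exact mul_right_cancel₀ ((map_ne_zero ι).2 hα0) h

end KummerConj

/-! ### The Kummer witness over `ℚ(ζ₃)/ℚ` -/

/-- **No rational number has cube `4`** (`2`-adic valuation). [folklore] -/
theorem rat_pow_three_ne_four (r : ℚ) : r ^ 3 ≠ 4 := by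
  intro hr
  have hv := congrArg (padicValRat 2) hr
  rw [padicValRat.pow, show (4 : ℚ) = ((2 ^ 2 : ℕ) : ℚ) by norm_num, padicValRat.of_nat,
    padicValNat.prime_pow] at hv
  omega

/-- **A coherent cubic family which is not `τ`-invariant** (hence
`¬ CoherentFamiliesTauInvariant`): `F₀ = ℚ`, `F = ℚ(ζ₃)` (any third cyclotomic field of `ℚ`;
`CyclotomicField 3 ℚ`), `τ` = complex conjugation, `α = ∛2 ∈ F̄`,
`χ : Gal(F(α)/F) ↪ ℂˣ` the Kummer character, `e j = χʲ ∘ r_{F(α)}`, `c v = χ(Frob_v)`, `Q` = the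
primes ramified in `F(α)`.  If `c (τ • w) = c w` off `Q ∪ τ⁻¹Q`, then `ψ = χ ∘ r` and its outer
conjugate `ψ ∘ θ_t` (`t̄ = τ`) have the same Frobenius data at almost all places, hence coincide
(density of Frobenii, `frobenius_dense` + Chebotarev PROVED in the tree); but `θ_t` turns
`σ α = u α` into `(θ_t σ) α = τ(u) α = u² α` (Kummer conjugation lemma), so `u² = u`, `u = 1`:
every `σ ∈ Γ_F` fixes `α`, `∛2 ∈ ℚ(ζ₃)`, and taking norms `N(∛2)³ = N(2) = 4` in `ℚ` — absurd.
(Copy of the `Summits`-side theorem of the same name; see the section doc above.)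
[folklore] -/
theorem exists_coherentFamily_not_tauInvariant :
    ∃ (F : Type) (_ : Field F) (_ : NumberField F) (_ : Algebra ℚ F) (τ : F ≃ₐ[ℚ] F),
      Module.finrank ℚ F = 2 ∧ τ ≠ 1 ∧
      ∃ (Q : Set (HeightOneSpectrum (𝓞 F))) (c : HeightOneSpectrum (𝓞 F) → ℂ)
        (e : ℕ → FramedGaloisRep F ℂ 1),
        Q.Finite ∧ (∀ v ∉ Q, c v ^ 3 = 1) ∧
        (∀ j : ℕ, ∀ v ∉ Q, (e j).HasFrobCharpolyAt v (X - C (c v ^ j))) ∧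
        ∃ w₀, w₀ ∉ Q ∧ τ • w₀ ∉ Q ∧ c (τ • w₀) ≠ c w₀ := by
  classical
  -- (0) it suffices to treat any third cyclotomic field `K` of `ℚ`; we then specialise to
  -- `CyclotomicField 3 ℚ` with its splitting-field `ℚ`-algebra (the one
  -- `CyclotomicField.isCyclotomicExtension` is stated for; `DivisionRing.toRatAlgebra` is only
  -- propositionally equal to it)
  suffices key : ∀ (K : Type) [Field K] [NumberField K] [Algebra ℚ K]
      [IsCyclotomicExtension {3} ℚ K], ∃ (τ : K ≃ₐ[ℚ] K), Module.finrank ℚ K = 2 ∧ τ ≠ 1 ∧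
      ∃ (Q : Set (HeightOneSpectrum (𝓞 K))) (c : HeightOneSpectrum (𝓞 K) → ℂ)
        (e : ℕ → FramedGaloisRep K ℂ 1),
        Q.Finite ∧ (∀ v ∉ Q, c v ^ 3 = 1) ∧
        (∀ j : ℕ, ∀ v ∉ Q, (e j).HasFrobCharpolyAt v (X - C (c v ^ j))) ∧
        ∃ w₀, w₀ ∉ Q ∧ τ • w₀ ∉ Q ∧ c (τ • w₀) ≠ c w₀ by
    letI hAlg : Algebra ℚ (CyclotomicField 3 ℚ) := CyclotomicField.algebra 3 ℚ
    obtain ⟨τ, h⟩ := key (CyclotomicField 3 ℚ)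
    exact ⟨CyclotomicField 3 ℚ, inferInstance, inferInstance, hAlg, τ, h⟩
  intro K _ _ _ _
  -- (1) the quadratic field `K = ℚ(ζ₃)`
  have h3 : (0 : ℕ) < 3 := by norm_num
  haveI : NeZero (3 : ℕ) := ⟨by norm_num⟩
  obtain ⟨ζ, hζ⟩ : ∃ ζ : K, IsPrimitiveRoot ζ 3 := ⟨_, IsCyclotomicExtension.zeta_spec 3 ℚ K⟩
  have hirr : Irreducible (cyclotomic 3 ℚ) := cyclotomic.irreducible_rat (by norm_num)
  have hdeg : Module.finrank ℚ K = 2 := by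
    rw [IsCyclotomicExtension.finrank K hirr]
    decide
  haveI hG : IsGalois ℚ K := IsCyclotomicExtension.isGalois {3} ℚ K
  -- (2) `τ ≠ 1`, and `τ ζ = ζ²`
  obtain ⟨τ, hτ⟩ : ∃ τ : K ≃ₐ[ℚ] K, τ ≠ 1 := by
    by_contra hall
    push Not at hall
    haveI : Subsingleton (K ≃ₐ[ℚ] K) := ⟨fun a b => (hall a).trans (hall b).symm⟩
    have h1 : Nat.card (K ≃ₐ[ℚ] K) = 1 := Nat.card_of_subsingleton (1 : K ≃ₐ[ℚ] K)
    have h2 : Nat.card (K ≃ₐ[ℚ] K) = Module.finrank ℚ K := IsGalois.card_aut_eq_finrank ℚ K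
    omega
  have hτζ : τ ζ = ζ ^ 2 := by
    obtain ⟨j, hj, hjζ⟩ := hζ.eq_pow_of_pow_eq_one (ξ := τ ζ)
      (by rw [← map_pow, hζ.pow_eq_one, map_one])
    interval_cases j
    · rw [pow_zero] at hjζ
      exact absurd (τ.injective (hjζ.symm.trans (map_one τ).symm)) (hζ.ne_one (by norm_num))
    · rw [pow_one] at hjζ
      exfalso
      apply hτ
      apply AlgEquiv.coe_toAlgHom_injective
      apply (hζ.powerBasis ℚ).algHom_ext
      rw [IsPrimitiveRoot.powerBasis_gen]
      exact hjζ.symm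
    · exact hjζ.symm
  -- (3) the Kummer field of `∛2` and its character
  have h2F : (2 : K) ≠ 0 := two_ne_zero
  obtain ⟨α, hα⟩ : ∃ α : AlgebraicClosure K, α ^ 3 = algebraMap K (AlgebraicClosure K) 2 :=
    IsAlgClosed.exists_pow_nat_eq _ h3
  have hα' : α ^ 3 = algebraMap K (AlgebraicClosure K) (algebraMap ℚ K 2) := by
    rw [map_ofNat]
    exact hα
  have hα0 : α ≠ 0 := KummerCharacter.root_ne_zero h3 h2F hα
  haveI : Algebra.IsAlgebraic ℚ (AlgebraicClosure K) :=
    Algebra.IsAlgebraic.trans ℚ K (AlgebraicClosure K)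
  let ι : AlgebraicClosure K →+* ℂ :=
    (IsAlgClosed.lift (R := ℚ) (M := ℂ) (S := AlgebraicClosure K)).toRingHom
  obtain ⟨χ, hχ⟩ := KummerCharacter.exists_character ι h3 hζ h2F hα
  haveI hfd : FiniteDimensional K K⟮α⟯ := KummerCharacter.finiteDimensional_adjoin h3 hα
  haveI hgal : IsGalois K K⟮α⟯ := KummerCharacter.isGalois_adjoin h3 hζ h2F hα
  haveI : NumberField K⟮α⟯ := NumberField.of_module_finite K _
  haveI hab : IsAbelianGalois K K⟮α⟯ := KummerCharacter.isAbelianGalois ι h3 hζ h2F hα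
  have hcomm : ∀ a b : K⟮α⟯ ≃ₐ[K] K⟮α⟯, Commute a b := commute_of_isAbelianGalois K⟮α⟯
  -- (4) the family `(Q, c, e)`
  let Q : Set (HeightOneSpectrum (𝓞 K)) := {v | ¬ Algebra.IsUnramifiedIn (𝓞 K⟮α⟯) v.asIdeal}
  have hQ : Q.Finite := finite_setOf_not_isUnramifiedIn K K⟮α⟯
  let c : HeightOneSpectrum (𝓞 K) → ℂ := fun v => ((χ (galFrob K K⟮α⟯ v) : ℂˣ) : ℂ)
  let e : ℕ → FramedGaloisRep K ℂ 1 := fun j => inflateCharacter K⟮α⟯ (χ ^ j)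
  have hc : ∀ v ∉ Q, c v ^ 3 = 1 := fun v _ => by
    show ((χ _ : ℂˣ) : ℂ) ^ 3 = 1
    rw [← Units.val_pow_eq_pow_val, KummerCharacter.pow_eq_one ι h3 h2F hα hχ, Units.val_one]
  have he : ∀ j : ℕ, ∀ v ∉ Q, (e j).HasFrobCharpolyAt v (X - C (c v ^ j)) := by
    intro j v hv
    have hunr : Algebra.IsUnramifiedIn (𝓞 K⟮α⟯) v.asIdeal := not_not.1 hv
    have h := inflateCharacter_hasFrobCharpolyAt K⟮α⟯ (χ ^ j) hcomm hunr
    simpa only [MonoidHom.pow_apply, Units.val_pow_eq_pow_val] using h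
  refine ⟨τ, hdeg, hτ, Q, c, e, hQ, hc, he, ?_⟩
  -- (5) suppose the family were `τ`-invariant off `Q`
  by_contra hinv
  push Not at hinv
  -- (6) `ψ = e 1` and its outer conjugate have the same Frobenius data off `S = Q ∪ τ⁻¹ Q`
  obtain ⟨t, ht⟩ := absGaloisQuot_surjective ℚ K τ
  let S : Set (HeightOneSpectrum (𝓞 K)) := Q ∪ (fun w => τ • w) ⁻¹' Q
  have hS : S.Finite := hQ.union (hQ.preimage (MulAction.injective τ).injOn)
  have hψ : ∀ w ∉ Q, (e 1).HasFrobCharpolyAt w (X - C (c w)) := fun w hw => by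
    simpa only [pow_one] using he 1 w hw
  have hψ' : ∀ w ∉ S, ((e 1).outerConj t).HasFrobCharpolyAt w (X - C (c w)) := fun w hw => by
    rw [FramedGaloisRep.hasFrobCharpolyAt_outerConj_iff, ht]
    have h1 : τ • w ∉ Q := fun h => hw (Or.inr h)
    have h2 : w ∉ Q := fun h => hw (Or.inl h)
    rw [← hinv w h2 h1]
    exact hψ (τ • w) h1
  -- (7) density of Frobenii: the two characters agree everywhere
  have hall : ∀ σ : absoluteGaloisGroup K,
      FramedRep.trace ((e 1).outerConj t) σ = FramedRep.trace (e 1) σ := by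
    have hD : {σ : absoluteGaloisGroup K | ∃ v ∉ S, ∃ 𝔓 ∈ v.primesAbove, IsArithFrobAt (𝓞 K) σ 𝔓} ⊆
        {σ | FramedRep.trace ((e 1).outerConj t) σ = FramedRep.trace (e 1) σ} := by
      rintro σ ⟨v, hv, 𝔓, h𝔓, hσ⟩
      have h1 : FramedRep.charpoly ((e 1).outerConj t) σ = X - C (c v) := hψ' v hv 𝔓 h𝔓 σ hσ
      have h2 : FramedRep.charpoly (e 1) σ = X - C (c v) := hψ v (fun h => hv (Or.inl h)) 𝔓 h𝔓 σ hσ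
      show FramedRep.trace ((e 1).outerConj t) σ = FramedRep.trace (e 1) σ
      haveI : Nonempty (Fin 1) := ⟨0⟩
      unfold FramedRep.trace
      rw [Matrix.trace_eq_neg_charpoly_coeff, Matrix.trace_eq_neg_charpoly_coeff]
      change -((FramedRep.charpoly ((e 1).outerConj t) σ).coeff _) =
        -((FramedRep.charpoly (e 1) σ).coeff _)
      rw [h1, h2]
    have hclosed : IsClosed {σ : absoluteGaloisGroup K |
        FramedRep.trace ((e 1).outerConj t) σ = FramedRep.trace (e 1) σ} :=
      isClosed_eq (FramedRep.continuous_trace _) (FramedRep.continuous_trace _)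
    intro σ
    have hmem : σ ∈ closure {σ : absoluteGaloisGroup K |
        ∃ v ∉ S, ∃ 𝔓 ∈ v.primesAbove, IsArithFrobAt (𝓞 K) σ 𝔓} := by
      rw [(absoluteGaloisGroup.frobenius_dense chebotarev_artinRep_holds K S hS).closure_eq]
      exact Set.mem_univ σ
    exact hclosed.closure_subset_iff.2 hD hmem
  have hval : ∀ σ : absoluteGaloisGroup K,
      (((e 1).outerConj t σ : GL (Fin 1) ℂ) : Matrix (Fin 1) (Fin 1) ℂ) 0 0 =
        ((e 1 σ : GL (Fin 1) ℂ) : Matrix (Fin 1) (Fin 1) ℂ) 0 0 := by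
    intro σ
    have h := hall σ
    unfold FramedRep.trace at h
    rwa [Matrix.trace_fin_one, Matrix.trace_fin_one] at h
  -- (8) every `σ ∈ Γ_F` acts on `α` through a cube root of unity of `K3`
  have hζ' : IsPrimitiveRoot (algebraMap K (AlgebraicClosure K) ζ) 3 :=
    hζ.map_of_injective (f := algebraMap K (AlgebraicClosure K))
      (algebraMap K (AlgebraicClosure K)).injective
  have hroot : ∀ σ : absoluteGaloisGroup K, ∃ i < 3,
      σ • α = algebraMap K (AlgebraicClosure K) (ζ ^ i) * α := by
    intro σ
    obtain ⟨i, hi, h⟩ := hζ'.eq_pow_of_pow_eq_one (ξ := (σ • α) * α⁻¹) (by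
      rw [mul_pow, ← smul_pow', hα, inv_pow, hα, absoluteGaloisGroup.smul_def, AlgEquiv.commutes,
        mul_inv_cancel₀]
      exact (map_ne_zero_iff _ (algebraMap K (AlgebraicClosure K)).injective).2 h2F)
    exact ⟨i, hi, by rw [map_pow, h, inv_mul_cancel_right₀ hα0]⟩
  -- (9) `θ_t` squares the root of unity, so it is `1`: `Γ_F` fixes `α`
  have hfixα : ∀ σ : absoluteGaloisGroup K, σ • α = α := by
    intro σ
    obtain ⟨i, -, hi⟩ := hroot σ
    have hθ := outerConj_smul_kummerRoot h3 hζ (two_ne_zero (α := ℚ)) hα' t σ hi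
    rw [ht] at hθ
    have h1 := inflate_kummer_apply_coe ι hα0 hχ 1 σ hi
    have h2 := inflate_kummer_apply_coe ι hα0 hχ 1 (absGaloisOuterConj ℚ K t σ) hθ
    rw [pow_one] at h1 h2
    have h4 : ι (algebraMap K (AlgebraicClosure K) (τ (ζ ^ i))) =
        ι (algebraMap K (AlgebraicClosure K) (ζ ^ i)) := by
      rw [← h1, ← h2]
      exact hval σ
    have h5 : τ (ζ ^ i) = ζ ^ i := (algebraMap K (AlgebraicClosure K)).injective (ι.injective h4)
    rw [map_pow, hτζ, ← pow_mul] at h5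
    have h6 : ζ ^ i = 1 := by
      have h7 : ζ ^ i * ζ ^ i = ζ ^ i * 1 := by rw [mul_one, ← pow_add, ← two_mul, h5]
      exact mul_left_cancel₀ (pow_ne_zero _ (hζ.ne_zero (by norm_num))) h7
    rw [hi, h6, map_one, one_mul]
  -- (10) hence `α ∈ K`: `∛2 ∈ ℚ(ζ₃)`
  have hαK : α ∈ (⊥ : IntermediateField K (AlgebraicClosure K)) := by
    haveI : IsGalois K (AlgebraicClosure K) := {}
    rw [← InfiniteGalois.fixedField_fixingSubgroup (⊥ : IntermediateField K (AlgebraicClosure K)),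
      IntermediateField.fixingSubgroup_bot]
    intro σ
    exact hfixα ((absoluteGaloisGroup.toAlgEquiv K).symm σ.1)
  obtain ⟨β, hβ⟩ := IntermediateField.mem_bot.1 hαK
  -- (11) norms: `N(β)³ = N(2) = 4` in `ℚ`
  have hβ3 : β ^ 3 = 2 := (algebraMap K (AlgebraicClosure K)).injective (by rw [map_pow, hβ, hα])
  have hN := congrArg (Algebra.norm ℚ) hβ3
  rw [map_pow, show (2 : K) = algebraMap ℚ K 2 by norm_num, Algebra.norm_algebraMap, hdeg] at hN
  exact rat_pow_three_ne_four _ (by rw [hN]; norm_num)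

-- names the `@[deprecated]` record `CoherentFamiliesTauInvariant` of this file on purpose: this IS its
-- refutation (verdict clean-up 2026-08-16); REMOVE-WHEN the record is deleted from this file
set_option linter.deprecated false in
/-- **`CoherentFamiliesTauInvariant` is FALSE** (the Kummer family of `∛2` over `ℚ(ζ₃)/ℚ` at
`p = 3`).  This is the refuting theorem the deprecated record points to.
(Copy of the `Summits`-side theorem of the same name; see the section doc above.)
[folklore] -/
theorem coherentFamiliesTauInvariant_false : ¬ CoherentFamiliesTauInvariant := by
  intro H
  obtain ⟨F, _, _, _, τ, hdeg, hτ, Q, c, e, hQ, hc, he, w₀, hw₀, hτw₀, hne⟩ :=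
    exists_coherentFamily_not_tauInvariant
  exact hne (H ℚ F τ hdeg hτ 3 Q c e Nat.prime_three le_rfl hQ hc he w₀ hw₀ hτw₀)

/-! ### Rank `0`: stub B is false as typed -/

/-- **Rank-0 cuspidal data exist** (the trivial group `GL_0`: `L²` of the one-point automorphic
quotient with the Dirac automorphic measure is a cuspidal automorphic representation,
`nonempty_cuspidalAutomorphicRepGL_zero`, and Borel–Jacquet 4.6 for `GL_n`
(`AutomorphicRepsGL.exists_cuspidalRepData_of_L2_holds`, PROVED) turns it into a datum).
(Copy of the `Summits`-side theorem of the same name; see the section doc above.)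
[folklore] -/
theorem nonempty_cuspidalAutomorphicRepData_zero (K : Type) [Field K] [NumberField K]
    (hcpt : isCompact_glFiniteIntegralLevel 0 K) :
    Nonempty (CuspidalAutomorphicRepData 0 K hcpt) := by
  let x : (AdelicGroupData.gl 0 K).automorphicQuotient :=
    (AdelicGroupData.gl 0 K).toAutomorphicQuotient 1
  haveI := isAutomorphicMeasure_dirac_gl_zero K x
  obtain ⟨P⟩ := nonempty_cuspidalAutomorphicRepGL_zero K (MeasureTheory.Measure.dirac x)
  obtain ⟨π, -, -⟩ :=
    AutomorphicRepsGL.exists_cuspidalRepData_of_L2_holds hcpt (MeasureTheory.Measure.dirac x) P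
  exact ⟨π⟩

-- names the `@[deprecated]` records `StubAdmissiblePowers` / `CoherentFamiliesTauInvariant` of this file on
-- purpose: this IS the reduction step of the refutation of stub B (verdict clean-up 2026-08-16); REMOVE-WHEN the
-- records are deleted from this file
set_option linter.deprecated false in
/-- **Stub B forces `τ`-invariance of every coherent family** (instantiate at `n = 0`, where a
cuspidal datum exists and every Satake parameter is the empty multiset, so the stub's conclusion
`β.map _ ≠ α.map _` is `0 ≠ 0`: the stub then says "all `j ∈ (0,p)` but one are impossible",
absurd for `p ≥ 3`).  Reduction step of the refutation `stubAdmissiblePowers_false`; both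
propositions named here are deprecated (refuted) records.
(Copy of the `Summits`-side theorem of the same name; see the section doc above.)
[folklore] -/
theorem coherentFamiliesTauInvariant_of_stubB (h : StubAdmissiblePowers) :
    CoherentFamiliesTauInvariant := by
  intro F₀ F _ _ _ _ _ τ hdeg hτ p Q c e hp hp3 hQ hc he w₀ hw₀ hτw₀
  by_contra hne
  obtain ⟨π⟩ := nonempty_cuspidalAutomorphicRepData_zero F
    (isCompact_glFiniteIntegralLevel_holds 0 F)
  obtain ⟨j₀, hj₀⟩ := h F₀ F τ hdeg hτ 0 _ π p Q c e hp hp.pos hQ hc he ⟨w₀, hw₀, hτw₀, hne⟩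
  obtain ⟨j, hj0, hjp, hjj⟩ : ∃ j, 0 < j ∧ j < p ∧ j ≠ j₀ := by
    by_cases h1 : j₀ = 1
    · exact ⟨2, by omega, by omega, by omega⟩
    · exact ⟨1, by omega, by omega, fun h => h1 h.symm⟩
  have hfreq := hj₀ j hj0 hjp hjj
  apply hfreq
  refine Filter.Eventually.of_forall fun w => ?_
  rintro ⟨α, β, a, a', hα, hβ, -, -, hne'⟩
  apply hne'
  rw [Multiset.card_eq_zero.1 hα.card_eq, Multiset.card_eq_zero.1 hβ.card_eq]
  simp

-- names the `@[deprecated]` records `StubAdmissiblePowers` / `CoherentFamiliesTauInvariant` of this file on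
-- purpose: this IS (a step of) the refutation of stub B (verdict clean-up 2026-08-16); REMOVE-WHEN the records
-- are deleted from this file
set_option linter.deprecated false in
/-- Hence: **stub B is false as soon as one coherent family is not `τ`-invariant.**
(Copy of the `Summits`-side theorem of the same name; see the section doc above.)
[folklore] -/
theorem stubAdmissiblePowers_false_of (h : ¬ CoherentFamiliesTauInvariant) :
    ¬ StubAdmissiblePowers :=
  fun hB => h (coherentFamiliesTauInvariant_of_stubB hB)

-- names the `@[deprecated]` record `StubAdmissiblePowers` of this file on purpose: this IS its refutation
-- (verdict clean-up 2026-08-16); REMOVE-WHEN the record is deleted from this file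
set_option linter.deprecated false in
/-- **`StubAdmissiblePowers` (stub B of the skeleton, verbatim) is FALSE** (rank `0` + the
Kummer family).  This is the refuting theorem the deprecated record points to.
(Copy of the `Summits`-side theorem of the same name; see the section doc above.)
[folklore] -/
theorem stubAdmissiblePowers_false : ¬ StubAdmissiblePowers :=
  stubAdmissiblePowers_false_of coherentFamiliesTauInvariant_false


end Literature.NumberTheory.GaloisRepresentations
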